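import Summits.ABC.ABC.Theses.FeketeScales
import Literature.Barriers.Parity.ElliottOriginalFormProofs

/-!
# `SparseGoodScales` (stmt-ABC-2161): the radicals of abc triples meet every window `(R^{1/Λ}, R]`

Negative / tightness support lemmas for the crux `Summit.ABC.ABC.Theses.FeketeScales.SparseGoodScales`
(line lead c6, line `SketchIdeator4`, registered stub `stub_droughtsOfSomeRatio`, "DA∃":
`∀ δ > 0, ∃ Λ > 1, ∀ N, ∃ R ≥ N, ∀ abc, rad ≤ R → R < rad^Λ → c ≤ rad^{1+δ}`).

The TTRL variant V3776 of that stub drops the side condition `0 < δ`.  It is FALSE, and the reason is a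
small structural fact recorded here by name:

* `exists_triple_rad_mem_window` — **for every `Λ > 1`, every large scale `R` carries an abc triple whose
  radical lies in the window `(R^{1/Λ}, R]`**, i.e. `rad ≤ R < rad^Λ`.  Witness: `(1, n, n+1)` with `n` and
  `n + 1` both squarefree, whose radical is EXACTLY `n (n+1)`; such `n` exist in every interval `(X, 41 X]`
  (`exists_sqfreePair_Ioc`, from the tree's count `#{n ≤ X : n, n+1 squarefree} ≥ X/40 − 1`,
  `Literature.Barriers.Parity.MRTCounterexample.card_sqfreePairs_ge`), and `X ≈ √R / 42` places
  `n (n+1)` in `(R/1764, R]`, inside the window once `R ≥ 1764^{Λ/(Λ−1)}`.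
* `not_droughtsAt_of_le_neg_half` — consequently the drought matrix of the stub fails for EVERY `δ ≤ −1/2`
  and EVERY `Λ > 1` (the witness has `c = n + 1 > (n(n+1))^{1/2} ≥ rad^{1+δ}`);
  `not_droughtsOfSomeRatio_allDelta` is the verbatim negation of V3776 (`0 < δ` cannot be dropped from
  `stub_droughtsOfSomeRatio`; what is really load-bearing is `−1/2 < δ`).
* `not_windowedAt_of_le_neg_one` — the same witness kills the windowed matrix of line `Sketch`'s
  `stub_windowedGoodScales` (`… → c ≤ R^{1+δ}`) for every `δ ≤ −1` and every `Λ > 1`;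
  `not_windowedGoodScalesAt_of_lt_neg_half` — and, choosing the ratio `Λ = 1/(2(1+δ))`, the windowed
  STATEMENT (`∀ Λ > 1, …`) for every `δ < −1/2` (appended by the same seat).

Scope (honest): these say nothing about the crux (which has `δ > 0`; `δ ≤ 0` is excluded for the crux
itself by `Negative.not_sparseGoodScalesAt_of_nonpos`, p104011), and they leave open exactly the near-hit
range `δ ∈ (−1/2, 0]` of the two windowed shapes — there the witnesses must be near-hits (`rad < c^{1+o(1)}`)
with radicals LOCATED in the window, which is abc-strength information on families such as
`(1, 2^x 3^y − 1, 2^x 3^y)` (the disprover's near-miss `windowed_false_at_zero`, Cruxes/…/Disproof.lean §7).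
-/

noncomputable section

set_option linter.dupNamespace false

namespace Summit.ABC.ABC.Theorems.SparseGoodScales.Negative

open Literature.NumberTheory.DiophantineGeometry UniqueFactorizationMonoid Finset

/-! ## Consecutive squarefree integers in every interval `(X, 41 X]` -/

/-- **Consecutive squarefree pairs in `(X, 41X]`.**  For `X ≥ 41` there is `n` with `X < n ≤ 41 X` and
`n`, `n + 1` both squarefree — from the count `#{n ≤ 41X : n, n+1 squarefree} ≥ 41X/40 − 1 > X`
(`card_sqfreePairs_ge`) against the trivial `#{n ≤ X} = X`. [folklore] -/
theorem exists_sqfreePair_Ioc {X : ℕ} (hX : 41 ≤ X) :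
    ∃ n : ℕ, X < n ∧ n ≤ 41 * X ∧ Squarefree n ∧ Squarefree (n + 1) := by
  classical
  by_contra hcon
  push Not at hcon
  have hsub : (Finset.Icc 1 (41 * X)).filter (fun n => Squarefree n ∧ Squarefree (n + 1)) ⊆
      Finset.Icc 1 X := by
    intro n hn
    rw [Finset.mem_filter, Finset.mem_Icc] at hn
    rw [Finset.mem_Icc]
    refine ⟨hn.1.1, ?_⟩
    by_contra hlt
    exact hcon n (not_le.mp hlt) hn.1.2 hn.2.1 hn.2.2
  have hcard := Finset.card_le_card hsub
  rw [Nat.card_Icc, Nat.add_sub_cancel] at hcard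
  have hge := Literature.Barriers.Parity.MRTCounterexample.card_sqfreePairs_ge (41 * X)
  have hle : ((#((Finset.Icc 1 (41 * X)).filter (fun n => Squarefree n ∧ Squarefree (n + 1))) : ℕ) : ℝ)
      ≤ X := by exact_mod_cast hcard
  have hX' : (41 : ℝ) ≤ X := by exact_mod_cast hX
  push_cast at hge
  linarith

/-! ## The witness triples `(1, n, n+1)` -/

/-- `(1, n, n + 1)` is an abc triple for every `n ≥ 1`. [folklore] -/
theorem isABCTriple_one_succ {n : ℕ} (hn : 1 ≤ n) : IsABCTriple 1 n (n + 1) :=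
  ⟨one_pos, hn, by omega, Nat.coprime_one_left n⟩

/-- For `n`, `n + 1` both squarefree the radical of `(1, n, n + 1)` is EXACTLY `n (n + 1)`. [folklore] -/
theorem rad_one_sqfreePair {n : ℕ} (hn : Squarefree n) (hn1 : Squarefree (n + 1)) :
    rad 1 n (n + 1) = n * (n + 1) := by
  have hcop : Nat.Coprime n (n + 1) := by
    rw [Nat.coprime_self_add_right]
    exact Nat.coprime_one_right n
  have hsq : Squarefree (n * (n + 1)) := (Nat.squarefree_mul hcop).mpr ⟨hn, hn1⟩
  rw [rad_def, one_mul, Nat.radical_eq_prod_primeFactors, Nat.prod_primeFactors_of_squarefree hsq]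

/-! ## Every window `(R^{1/Λ}, R]` is hit -/

/-- **Squarefree consecutive products in every window.**  For every `Λ > 1` and every large `R` there is
`n ≥ 1` with `n`, `n + 1` squarefree and `n (n+1) ≤ R < (n (n+1))^Λ`.  (Take `X = ⌊√R⌋ / 42 ≥ 41`,
`n ∈ (X, 41X]` by `exists_sqfreePair_Ioc`; then `R/1764 < n(n+1) ≤ R`, and `(R/1764)^Λ > R` once
`R > 1764^{Λ/(Λ−1)}`.) [folklore] -/
theorem exists_sqfreePair_window {Λ : ℝ} (hΛ : 1 < Λ) :
    ∃ N : ℕ, ∀ R : ℕ, N ≤ R → ∃ n : ℕ, 1 ≤ n ∧ Squarefree n ∧ Squarefree (n + 1) ∧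
      n * (n + 1) ≤ R ∧ (R : ℝ) < ((n * (n + 1) : ℕ) : ℝ) ^ Λ := by
  have hΛ1 : 0 < Λ - 1 := by linarith
  set M : ℝ := (1764 : ℝ) ^ (Λ / (Λ - 1)) with hM
  refine ⟨max 2965284 (⌈M⌉₊ + 1), fun R hR => ?_⟩
  have hR1 : 2965284 ≤ R := le_trans (le_max_left _ _) hR
  have hR2 : ⌈M⌉₊ + 1 ≤ R := le_trans (le_max_right _ _) hR
  -- the integer window `(X, 41 X]`, `X = ⌊√R⌋ / 42`
  set s : ℕ := Nat.sqrt R with hs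
  set X : ℕ := s / 42 with hX
  have hs1722 : 1722 ≤ s := by
    rw [hs, Nat.le_sqrt]
    omega
  have hX41 : 41 ≤ X := by omega
  obtain ⟨n, hXn, hn41, hsq, hsq1⟩ := exists_sqfreePair_Ioc hX41
  refine ⟨n, by omega, hsq, hsq1, ?_, ?_⟩
  · -- `n (n+1) ≤ (42 X)^2 ≤ s^2 ≤ R`
    have h1 : n * (n + 1) ≤ 42 * X * (42 * X) := by nlinarith
    have h2 : 42 * X ≤ s := by omega
    calc n * (n + 1) ≤ 42 * X * (42 * X) := h1
      _ ≤ s * s := Nat.mul_le_mul h2 h2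
      _ ≤ R := Nat.sqrt_le R
  · -- `R < 1764 · n (n+1)` and `R > 1764^{Λ/(Λ-1)}` give `R < (n (n+1))^Λ`
    have hlow : (R : ℝ) < 1764 * ((n * (n + 1) : ℕ) : ℝ) := by
      have h1 : R < (s + 1) * (s + 1) := Nat.lt_succ_sqrt R
      have h2 : s + 1 ≤ 42 * (X + 1) := by omega
      have h3 : (s + 1) * (s + 1) ≤ 42 * (X + 1) * (42 * (X + 1)) := Nat.mul_le_mul h2 h2
      have h4 : (X + 1) * (X + 1) ≤ n * (n + 1) := by nlinarith
      have h5 : R < 1764 * (n * (n + 1)) := by nlinarith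
      have h6 : ((R : ℕ) : ℝ) < ((1764 * (n * (n + 1)) : ℕ) : ℝ) := by exact_mod_cast h5
      push_cast at h6 ⊢
      linarith
    have hRpos : (0 : ℝ) < R := by
      have : (2965284 : ℝ) ≤ R := by exact_mod_cast hR1
      linarith
    have hRM : M < R := by
      have h1 : M ≤ ⌈M⌉₊ := Nat.le_ceil M
      have h2 : ((⌈M⌉₊ + 1 : ℕ) : ℝ) ≤ R := by exact_mod_cast hR2
      push_cast at h2
      linarith
    have hC0 : (0 : ℝ) < 1764 := by norm_num
    have hM0 : 0 ≤ M := Real.rpow_nonneg hC0.le _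
    have hkey : (1764 : ℝ) ^ Λ < (R : ℝ) ^ (Λ - 1) := by
      have h := Real.rpow_lt_rpow hM0 hRM hΛ1
      rwa [hM, ← Real.rpow_mul hC0.le, div_mul_cancel₀ _ hΛ1.ne'] at h
    have hRΛ : (R : ℝ) * (1764 : ℝ) ^ Λ < (R : ℝ) ^ Λ := by
      have h1 : (R : ℝ) ^ Λ = (R : ℝ) ^ (Λ - 1) * R := by
        rw [← Real.rpow_add_one hRpos.ne' (Λ - 1)]
        ring_nf
      rw [h1, mul_comm ((R : ℝ) ^ (Λ - 1))]
      exact mul_lt_mul_of_pos_left hkey hRpos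
    have hCΛ : (0 : ℝ) < (1764 : ℝ) ^ Λ := Real.rpow_pos_of_pos hC0 Λ
    have hdiv : (R : ℝ) < ((R : ℝ) / 1764) ^ Λ := by
      rw [Real.div_rpow hRpos.le hC0.le, lt_div_iff₀ hCΛ]
      exact hRΛ
    have hrad : (R : ℝ) / 1764 < ((n * (n + 1) : ℕ) : ℝ) := by
      rw [div_lt_iff₀ hC0]
      linarith
    calc (R : ℝ) < ((R : ℝ) / 1764) ^ Λ := hdiv
      _ < (((n * (n + 1) : ℕ) : ℝ)) ^ Λ :=
          Real.rpow_lt_rpow (by positivity) hrad (by linarith)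

/-- **The radicals of abc triples meet every window `(R^{1/Λ}, R]`.**  For every `Λ > 1` there is `N`
such that every scale `R ≥ N` carries an abc triple with `rad ≤ R < rad^Λ` (witness `(1, n, n+1)`,
`n, n+1` squarefree).  So the window hypothesis of the drought / windowed stubs of the crux
`SparseGoodScales` is never vacuous at large scales. [folklore] -/
theorem exists_triple_rad_mem_window {Λ : ℝ} (hΛ : 1 < Λ) :
    ∃ N : ℕ, ∀ R : ℕ, N ≤ R → ∃ a b c : ℕ, IsABCTriple a b c ∧ rad a b c ≤ R ∧
      (R : ℝ) < ((rad a b c : ℕ) : ℝ) ^ Λ := by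
  obtain ⟨N, hN⟩ := exists_sqfreePair_window hΛ
  refine ⟨N, fun R hR => ?_⟩
  obtain ⟨n, hn1, hsq, hsq1, hle, hlt⟩ := hN R hR
  refine ⟨1, n, n + 1, isABCTriple_one_succ hn1, ?_, ?_⟩
  · rwa [rad_one_sqfreePair hsq hsq1]
  · rwa [rad_one_sqfreePair hsq hsq1]

/-! ## Consequences: `−1/2 < δ` is load-bearing in the drought stub, `−1 < δ` in the windowed stub -/

/-- Key inequality for the witness: `n + 1 > (n (n+1))^{e}` whenever `e ≤ 1/2` (and `n ≥ 1`). [folklore] -/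
theorem succ_gt_rpow_mul_succ {n : ℕ} (hn : 1 ≤ n) {e : ℝ} (he : e ≤ 1 / 2) :
    ((n * (n + 1) : ℕ) : ℝ) ^ e < ((n + 1 : ℕ) : ℝ) := by
  have hn' : (1 : ℝ) ≤ n := by exact_mod_cast hn
  have hbase : (1 : ℝ) ≤ ((n * (n + 1) : ℕ) : ℝ) := by
    have : 1 ≤ n * (n + 1) := by nlinarith
    exact_mod_cast this
  have h1 : ((n * (n + 1) : ℕ) : ℝ) ^ e ≤ ((n * (n + 1) : ℕ) : ℝ) ^ ((1 : ℝ) / 2) :=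
    Real.rpow_le_rpow_of_exponent_le hbase he
  have h2 : ((n * (n + 1) : ℕ) : ℝ) < (((n + 1 : ℕ) : ℝ)) ^ (2 : ℕ) := by
    have : n * (n + 1) < (n + 1) ^ 2 := by nlinarith
    exact_mod_cast this
  have h3 : ((n * (n + 1) : ℕ) : ℝ) ^ ((1 : ℝ) / 2) < ((((n + 1 : ℕ) : ℝ)) ^ (2 : ℕ)) ^ ((1 : ℝ) / 2) :=
    Real.rpow_lt_rpow (by positivity) h2 (by norm_num)
  have h4 : ((((n + 1 : ℕ) : ℝ)) ^ (2 : ℕ)) ^ ((1 : ℝ) / 2) = ((n + 1 : ℕ) : ℝ) := by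
    rw [← Real.rpow_natCast, ← Real.rpow_mul (by positivity)]
    norm_num
  linarith [h4 ▸ h3]

/-- **The drought matrix fails for every `δ ≤ −1/2` and every `Λ > 1`.**  (Body of
`stub_droughtsOfSomeRatio` with `δ`, `Λ` free: `∀ N ∃ R ≥ N ∀ abc, rad ≤ R → R < rad^Λ → c ≤ rad^{1+δ}`.)
The witness `(1, n, n+1)` of `exists_sqfreePair_window` sits in the window and has
`c = n + 1 > (n(n+1))^{1/2} ≥ rad^{1+δ}`. [folklore] -/
theorem not_droughtsAt_of_le_neg_half {δ : ℝ} (hδ : δ ≤ -1 / 2) {Λ : ℝ} (hΛ : 1 < Λ) :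
    ¬ ∀ N : ℕ, ∃ R : ℕ, N ≤ R ∧ ∀ a b c : ℕ, IsABCTriple a b c → rad a b c ≤ R →
      (R : ℝ) < ((rad a b c : ℕ) : ℝ) ^ Λ → (c : ℝ) ≤ ((rad a b c : ℕ) : ℝ) ^ (1 + δ) := by
  intro h
  obtain ⟨N, hN⟩ := exists_sqfreePair_window hΛ
  obtain ⟨R, hNR, hR⟩ := h N
  obtain ⟨n, hn1, hsq, hsq1, hle, hlt⟩ := hN R hNR
  have ht := isABCTriple_one_succ hn1
  have hrad := rad_one_sqfreePair hsq hsq1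
  have hc := hR 1 n (n + 1) ht (by rw [hrad]; exact hle) (by rw [hrad]; exact hlt)
  rw [hrad] at hc
  have hgt := succ_gt_rpow_mul_succ hn1 (e := 1 + δ) (by linarith)
  push_cast at hc hgt
  linarith

/-- **`0 < δ` cannot be dropped from `stub_droughtsOfSomeRatio`** (TTRL variant V3776 of stmt-ABC-2161,
verbatim, is false): at `δ = −1` (indeed at every `δ ≤ −1/2`) no ratio `Λ > 1` admits arbitrarily large
drought scales. [folklore] -/
theorem not_droughtsOfSomeRatio_allDelta :
    ¬ ∀ δ : ℝ, ∃ Λ : ℝ, 1 < Λ ∧ ∀ N : ℕ, ∃ R : ℕ, N ≤ R ∧ ∀ a b c : ℕ,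
      IsABCTriple a b c → rad a b c ≤ R → (R : ℝ) < ((rad a b c : ℕ) : ℝ) ^ Λ →
        (c : ℝ) ≤ ((rad a b c : ℕ) : ℝ) ^ (1 + δ) := by
  intro h
  obtain ⟨Λ, hΛ, hmat⟩ := h (-1)
  exact not_droughtsAt_of_le_neg_half (by norm_num) hΛ hmat

/-- **The windowed matrix fails for every `δ ≤ −1` and every `Λ > 1`.**  (Body of line `Sketch`'s
`stub_windowedGoodScales` with `δ`, `Λ` free: `∀ N ∃ R ≥ N ∀ abc, rad ≤ R → R < rad^Λ → c ≤ R^{1+δ}`.)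
At `δ ≤ −1` the bound `R^{1+δ} ≤ 1 < 2 ≤ c` fails for the window witness of
`exists_triple_rad_mem_window`. [folklore] -/
theorem not_windowedAt_of_le_neg_one {δ : ℝ} (hδ : δ ≤ -1) {Λ : ℝ} (hΛ : 1 < Λ) :
    ¬ ∀ N : ℕ, ∃ R : ℕ, N ≤ R ∧ ∀ a b c : ℕ, IsABCTriple a b c → rad a b c ≤ R →
      (R : ℝ) < ((rad a b c : ℕ) : ℝ) ^ Λ → (c : ℝ) ≤ (R : ℝ) ^ (1 + δ) := by
  intro h
  obtain ⟨N, hN⟩ := exists_triple_rad_mem_window hΛ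
  obtain ⟨R, hNR, hR⟩ := h (max N 1)
  obtain ⟨a, b, c, ht, hle, hlt⟩ := hN R (le_trans (le_max_left _ _) hNR)
  have hc := hR a b c ht hle hlt
  have hR1 : (1 : ℝ) ≤ R := by exact_mod_cast le_trans (le_max_right N 1) hNR
  have hpow : (R : ℝ) ^ (1 + δ) ≤ 1 := Real.rpow_le_one_of_one_le_of_nonpos hR1 (by linarith)
  have hc2 : (2 : ℝ) ≤ c := by
    obtain ⟨ha, hb, habc, -⟩ := ht
    exact_mod_cast (show 2 ≤ c by omega)
  linarith

/-- **The windowed statement fails for every `δ < −1/2`.**  (Line `Sketch`'s `stub_windowedGoodScales`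
with `δ` free: `∀ Λ > 1, ∀ N, ∃ R ≥ N, ∀ abc, rad ≤ R → R < rad^Λ → c ≤ R^{1+δ}`; together with
`not_droughtsAt_of_le_neg_half` this makes `−1/2 ≤ δ` load-bearing in BOTH windowed shapes.)  For
`−1 < δ < −1/2` take the ratio `Λ = 1/(2(1+δ)) > 1`: inside the window
`R^{1+δ} < rad^{Λ(1+δ)} = rad^{1/2} = (n(n+1))^{1/2} < n + 1 = c` for the witness `(1, n, n+1)` of
`exists_sqfreePair_window`; for `δ ≤ −1` any `Λ > 1` works (`not_windowedAt_of_le_neg_one`). [folklore] -/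
theorem not_windowedGoodScalesAt_of_lt_neg_half {δ : ℝ} (hδ : δ < -1 / 2) :
    ¬ ∀ Λ : ℝ, 1 < Λ → ∀ N : ℕ, ∃ R : ℕ, N ≤ R ∧ ∀ a b c : ℕ, IsABCTriple a b c →
      rad a b c ≤ R → (R : ℝ) < ((rad a b c : ℕ) : ℝ) ^ Λ → (c : ℝ) ≤ (R : ℝ) ^ (1 + δ) := by
  intro h
  by_cases hδ1 : δ ≤ -1
  · exact not_windowedAt_of_le_neg_one hδ1 (Λ := 2) (by norm_num) (h 2 (by norm_num))
  · have hδ1' : -1 < δ := lt_of_not_ge hδ1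
    have h1δ : 0 < 1 + δ := by linarith
    have h2δ : (0 : ℝ) < 2 * (1 + δ) := by linarith
    set Λ : ℝ := 1 / (2 * (1 + δ)) with hΛdef
    have hΛ : 1 < Λ := by
      rw [hΛdef, lt_div_iff₀ h2δ]
      linarith
    obtain ⟨N, hN⟩ := exists_sqfreePair_window hΛ
    obtain ⟨R, hNR, hR⟩ := h Λ hΛ N
    obtain ⟨n, hn1, hsq, hsq1, hle, hlt⟩ := hN R hNR
    have ht := isABCTriple_one_succ hn1
    have hrad := rad_one_sqfreePair hsq hsq1
    have hc := hR 1 n (n + 1) ht (by rw [hrad]; exact hle) (by rw [hrad]; exact hlt)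
    have hRpos : (0 : ℝ) ≤ R := by positivity
    have h1 : (R : ℝ) ^ (1 + δ) < (((n * (n + 1) : ℕ) : ℝ) ^ Λ) ^ (1 + δ) :=
      Real.rpow_lt_rpow hRpos hlt h1δ
    have h2 : (((n * (n + 1) : ℕ) : ℝ) ^ Λ) ^ (1 + δ) = ((n * (n + 1) : ℕ) : ℝ) ^ ((1 : ℝ) / 2) := by
      rw [← Real.rpow_mul (by positivity), hΛdef]
      congr 1
      field_simp
    have h3 := succ_gt_rpow_mul_succ hn1 (e := (1 : ℝ) / 2) le_rfl
    rw [h2] at h1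
    push_cast at hc h1 h3
    linarith

end Summit.ABC.ABC.Theorems.SparseGoodScales.Negative
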